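import Mathlib.NumberTheory.Zsqrtd.Basic
import Mathlib.RingTheory.Ideal.Operations
import Mathlib.RingTheory.Ideal.Span
import Mathlib.Data.ZMod.Basic
import Mathlib.Tactic.Ring
import Mathlib.Tactic.NormNum
import Mathlib.Tactic.LinearCombination
import HarnessLib

/-!
# Venture HSemireg — the IDEAL INPUTS of the PROBE5 §19 REAL-PAIR CENSUSES (ℚ(√10), ℚ(√15)): the principal products
# `𝔭₂𝔮₃ = (4+√10)`, `𝔭₂𝔭₅ = (√10)`, `𝔮₃′𝔭₅ = (5+√10)` in `ℤ√10` and `𝔭₂𝔭₃ = (3+√15)`, `𝔭₂𝔭₅ = (5+√15)`, `𝔭₃𝔭₅ = (√15)`, `𝔭₃𝔭₇ = (6+√15)`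
# in `ℤ√15`, the norms and their SIGNS (−6, +10, −15, +21), the unit `3+√10` of norm `−1`, the absence of a norm-`−1` unit in `ℤ√15`, and the
# congruence obstructions making `𝔭₂, 𝔮₃` (m = 10) and `𝔭₂, 𝔭₃, 𝔭₅, 𝔭₇` (m = 15) non-principal — kernel arithmetic

HONEST FRAMING. Lean index of the computation cell `pub-hsemireg`, widening group ENGINE-W (code A, seat `engine-w-1`, gen 18).
IDEAL ARITHMETIC IN `ℤ√10`, `ℤ√15` (Mathlib `Ideal.span`) AND CONGRUENCES ONLY. What is NOT formalised: class numbers (`h(ℤ[√10]) = h(ℤ[√15]) = 2`),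
that the displayed two-generated ideals are prime, the census itself (76 cells), the transports, or anything object-level; nothing here says that HC,
HC_CM or HC_AV holds. Theorems only (0 `def`, 0 named fact, 0 `sorry`). New namespace `RealPairCensus`. Companion: `PairTransportMatrix.lean` (#43:
the matrix `P = [v w]` that realises every criterion-allowed cell, with certificates in exactly these two fields).

SOURCE (the cell's own result, by value): `widen/ENGINE-W/out/probe5/PROBE5-STIZ-A.md` §19 «CENSUSES … ℚ(√10) (h(ℤ[√10]) = 2, unit 3+√10 of norm −1:
class condition only; 𝔭₂, 𝔮₃, 𝔮₅… non-principal, 𝔭₂𝔮₃ = (4+√10), 𝔭₂𝔮₅ = (√10), 𝔮₃𝔮₅ = (5+√10)) … ℚ(√15) (h = 2, NO unit of norm −1: class AND sign —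
𝔭₂𝔭₃ = (3+√15) principal but N = −6 ⇒ forbidden; 𝔭₂𝔭₅ = (5+√15), N = +10 ⇒ allowed; 𝔭₃𝔭₅ = (√15), N = −15 ⇒ forbidden; 𝔭₃𝔭₇ = (6+√15), +21 ⇒
allowed) … 76 cells: 38 criterion-allowed — 38∕38 CONSTRUCTED …; 38 criterion-forbidden (32 by CLASS …, 6 by SIGN …) — 0 solver hits».
PRECISION (which prime above 3 resp. 7): with `𝔮₃ := (3, 1+√10)` one has `𝔭₂𝔮₃ = (4+√10)` but `(5+√10) = 𝔮₃′𝔭₅` for the CONJUGATE `𝔮₃′ = (3, 1−√10)`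
(`5+√10 ≡ 1+√10 ≢ 0 mod 𝔮₃`); likewise `(6+√15) = 𝔭₃·(7, −1+√15)`. The card's unprimed «𝔮₃𝔮₅», «𝔭₃𝔭₇» are to be read with these representatives;
nothing in the census depends on the choice (both primes above 3, resp. 7, lie in the non-trivial class). What the kernel holds:

* products (each as `Ideal.span {a, b} * Ideal.span {c, d} = Ideal.span {γ}`, proved by four explicit quotients for `⊆` and one explicit combination
  for `⊇`): `p2_q3_sqrt10`, `p2_p5_sqrt10`, `q3conj_p5_sqrt10`; `p2_p3_sqrt15`, `p2_p5_sqrt15`, `p3_p5_sqrt15`, `p3_p7_sqrt15`.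
* norms and signs: `norms_sqrt10` (`N(4+√10) = 6`, `N(√10) = −10`, `N(5+√10) = 15`, `N(3+√10) = −1` — a unit of norm −1, so signs are adjustable),
  `norms_sqrt15` (`N(3+√15) = −6`, `N(5+√15) = 10`, `N(√15) = −15`, `N(6+√15) = 21`).
* obstructions: `no_norm_neg_one_sqrt15` (`x² − 15y² ≠ −1`, mod 3), `no_small_norms_sqrt15` (`x² − 15y² ∉ {±2, ±3, ±7}`, mod 5 ∕ mod 3 ∕ mod 5) and
  `no_small_norms_sqrt10` (`x² − 10y² ∉ {±2, ±3}`, mod 5) — so no element has the norm ±2, ±3 (±7) that a generator of `𝔭₂`, `𝔮₃`∕`𝔭₃` (`𝔭₇`) would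
  have (ideal norms 2, 3, 7 by value), and in `ℤ√15` no principal product of negative norm can be re-signed.
-/

namespace Summit.Ventures.HSemireg.RealPairCensus

open Ideal

/-- Product of two two-generated ideals inside a principal ideal, from the four generator products. -/
private theorem span_pair_mul_le {R : Type*} [CommRing R] {a b c d γ : R}
    (hac : γ ∣ a * c) (had : γ ∣ a * d) (hbc : γ ∣ b * c) (hbd : γ ∣ b * d) :
    Ideal.span {a, b} * Ideal.span {c, d} ≤ Ideal.span {γ} := by
  rw [Ideal.mul_le]
  intro x hx y hy
  obtain ⟨u, v, rfl⟩ := Ideal.mem_span_pair.1 hx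
  obtain ⟨u', v', rfl⟩ := Ideal.mem_span_pair.1 hy
  rw [Ideal.mem_span_singleton]
  have e : (u * a + v * b) * (u' * c + v' * d) = (u * u') * (a * c) + (u * v') * (a * d) + (v * u') * (b * c) + (v * v') * (b * d) := by ring
  rw [e]
  exact dvd_add (dvd_add (dvd_add (dvd_mul_of_dvd_right hac _) (dvd_mul_of_dvd_right had _)) (dvd_mul_of_dvd_right hbc _))
    (dvd_mul_of_dvd_right hbd _)

/-- A principal ideal inside the product, from one combination `γ = s·(a·c′) + r·(b·d′)` of two generator products (the shape used below). -/
private theorem span_singleton_le_mul {R : Type*} [CommRing R] {a b c d γ : R} (x y : R) (r s : R)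
    (hx : x = a ∨ x = b) (hy : y = c ∨ y = d) (hx' : r = a ∨ r = b) (hy' : s = c ∨ s = d) (t₁ t₂ : R)
    (e : γ = t₁ * (x * y) + t₂ * (r * s)) :
    Ideal.span {γ} ≤ Ideal.span {a, b} * Ideal.span {c, d} := by
  rw [Ideal.span_singleton_le_iff_mem, e]
  have hxm : x ∈ Ideal.span {a, b} := Ideal.subset_span (by rcases hx with h | h <;> simp [h])
  have hym : y ∈ Ideal.span {c, d} := Ideal.subset_span (by rcases hy with h | h <;> simp [h])
  have hrm : r ∈ Ideal.span {a, b} := Ideal.subset_span (by rcases hx' with h | h <;> simp [h])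
  have hsm : s ∈ Ideal.span {c, d} := Ideal.subset_span (by rcases hy' with h | h <;> simp [h])
  exact Ideal.add_mem _ (Ideal.mul_mem_left _ t₁ (Ideal.mul_mem_mul hxm hym)) (Ideal.mul_mem_left _ t₂ (Ideal.mul_mem_mul hrm hsm))

/-! ## §1 `ℤ√10` -/

/-- **`𝔭₂𝔮₃ = (4 + √10)`** with `𝔭₂ = (2, √10)`, `𝔮₃ = (3, 1 + √10)`: quotients `6 = γ(4−√10)`, `2(1+√10) = γ(−2+√10)`, `3√10 = γ(−5+2√10)`,
`√10(1+√10) = γ(5−√10)`; and `γ = √10·(1+√10) − 2·3`. [kernel] -/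
theorem p2_q3_sqrt10 :
    Ideal.span {(2 : ℤ√10), ⟨0, 1⟩} * Ideal.span {(3 : ℤ√10), ⟨1, 1⟩} = Ideal.span {(⟨4, 1⟩ : ℤ√10)} := by
  apply le_antisymm
  · apply span_pair_mul_le
    · exact ⟨⟨4, -1⟩, by ext <;> simp⟩
    · exact ⟨⟨-2, 1⟩, by ext <;> simp⟩
    · exact ⟨⟨-5, 2⟩, by ext <;> simp⟩
    · exact ⟨⟨5, -1⟩, by ext <;> simp⟩
  · exact span_singleton_le_mul ⟨0, 1⟩ ⟨1, 1⟩ 2 3 (Or.inr rfl) (Or.inr rfl) (Or.inl rfl) (Or.inl rfl) 1 (-1) (by ext <;> simp)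

/-- **`𝔭₂𝔭₅ = (√10)`** with `𝔭₅ = (5, √10)`: `10 = √10·√10`, and `√10 = 1·(√10·5) − 2·(2·√10)`. [kernel] -/
theorem p2_p5_sqrt10 :
    Ideal.span {(2 : ℤ√10), ⟨0, 1⟩} * Ideal.span {(5 : ℤ√10), ⟨0, 1⟩} = Ideal.span {(⟨0, 1⟩ : ℤ√10)} := by
  apply le_antisymm
  · apply span_pair_mul_le
    · exact ⟨⟨0, 1⟩, by ext <;> simp⟩
    · exact ⟨2, by ext <;> simp⟩
    · exact ⟨5, by ext <;> simp⟩
    · exact ⟨⟨0, 1⟩, by ext <;> simp⟩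
  · exact span_singleton_le_mul ⟨0, 1⟩ 5 2 ⟨0, 1⟩ (Or.inr rfl) (Or.inl rfl) (Or.inl rfl) (Or.inr rfl) 1 (-2) (by ext <;> simp)

/-- **`𝔮₃′𝔭₅ = (5 + √10)`** with the CONJUGATE prime `𝔮₃′ = (3, 1 − √10)`: quotients `15 = γ(5−√10)`, `3√10 = γ(−2+√10)`,
`5(1−√10) = γ(5−2√10)`, `√10(1−√10) = γ(−4+√10)`; and `γ = 1·(3·5) + 1·((1−√10)·√10)`. [kernel] -/
theorem q3conj_p5_sqrt10 :
    Ideal.span {(3 : ℤ√10), ⟨1, -1⟩} * Ideal.span {(5 : ℤ√10), ⟨0, 1⟩} = Ideal.span {(⟨5, 1⟩ : ℤ√10)} := by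
  apply le_antisymm
  · apply span_pair_mul_le
    · exact ⟨⟨5, -1⟩, by ext <;> simp⟩
    · exact ⟨⟨-2, 1⟩, by ext <;> simp⟩
    · exact ⟨⟨5, -2⟩, by ext <;> simp⟩
    · exact ⟨⟨-4, 1⟩, by ext <;> simp⟩
  · exact span_singleton_le_mul 3 5 ⟨1, -1⟩ ⟨0, 1⟩ (Or.inl rfl) (Or.inl rfl) (Or.inr rfl) (Or.inr rfl) 1 1 (by ext <;> simp)

/-- `5 + √10` does NOT lie in `𝔮₃ = (3, 1+√10)` — it lies in the conjugate: `5 + √10 ∉ (3, 1+√10)` because every element `u·3 + v·(1+√10)`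
has `re − im ≡ 0 (mod 3)` while `5 − 1 = 4`. [kernel] -/
theorem five_add_sqrt10_not_mem_q3 : (⟨5, 1⟩ : ℤ√10) ∉ Ideal.span {(3 : ℤ√10), ⟨1, 1⟩} := by
  intro h
  obtain ⟨u, v, huv⟩ := Ideal.mem_span_pair.1 h
  have hre := congrArg Zsqrtd.re huv
  have him := congrArg Zsqrtd.im huv
  simp at hre him
  omega

/-- **Norms in `ℤ√10`**: `N(4+√10) = 6`, `N(√10) = −10`, `N(5+√10) = 15`, and `N(3+√10) = −1` (a unit of norm `−1`: signs of generators are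
adjustable, «class condition only»). [kernel, `decide`] -/
theorem norms_sqrt10 :
    (⟨4, 1⟩ : ℤ√10) * ⟨4, -1⟩ = 6 ∧ (⟨0, 1⟩ : ℤ√10) * ⟨0, -1⟩ = -10 ∧ (⟨5, 1⟩ : ℤ√10) * ⟨5, -1⟩ = 15 ∧ (⟨3, 1⟩ : ℤ√10) * ⟨3, -1⟩ = -1 := by
  decide

/-- **No element of `ℤ√10` has norm `±2` or `±3`** (squares mod 5 are `0, 1, 4`): so `𝔭₂` (norm 2) and `𝔮₃, 𝔮₃′` (norm 3) are not principal
(ideal norms by value). [kernel] -/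
theorem no_small_norms_sqrt10 (x y : ℤ) :
    x ^ 2 - 10 * y ^ 2 ≠ 2 ∧ x ^ 2 - 10 * y ^ 2 ≠ -2 ∧ x ^ 2 - 10 * y ^ 2 ≠ 3 ∧ x ^ 2 - 10 * y ^ 2 ≠ -3 := by
  have key : ∀ k : ℤ, x ^ 2 - 10 * y ^ 2 = k → (x : ZMod 5) ^ 2 = (k : ZMod 5) := by
    intro k hk
    have h := congrArg (Int.cast : ℤ → ZMod 5) hk
    push_cast at h
    have h10 : (10 : ZMod 5) = 0 := by decide
    rw [h10, zero_mul, sub_zero] at h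
    exact h
  have sq : ∀ a : ZMod 5, a ^ 2 ≠ 2 ∧ a ^ 2 ≠ -2 ∧ a ^ 2 ≠ 3 ∧ a ^ 2 ≠ -3 := by decide
  refine ⟨fun h => (sq _).1 (by simpa using key 2 h), fun h => (sq _).2.1 (by simpa using key (-2) h),
    fun h => (sq _).2.2.1 (by simpa using key 3 h), fun h => (sq _).2.2.2 (by simpa using key (-3) h)⟩

/-! ## §2 `ℤ√15` -/

/-- **`𝔭₂𝔭₃ = (3 + √15)`** with `𝔭₂ = (2, 1+√15)`, `𝔭₃ = (3, √15)`: quotients `6 = γ·(−(3−√15))`, `2√15 = γ(5−√15)`, `3(1+√15) = γ(6−√15)`,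
`√15(1+√15) = γ(−5+2√15)`; and `γ = 1·((1+√15)·3) − 1·(2·√15)`. Norm `−6` < 0: principal but FORBIDDEN (sign). [kernel] -/
theorem p2_p3_sqrt15 :
    Ideal.span {(2 : ℤ√15), ⟨1, 1⟩} * Ideal.span {(3 : ℤ√15), ⟨0, 1⟩} = Ideal.span {(⟨3, 1⟩ : ℤ√15)} := by
  apply le_antisymm
  · apply span_pair_mul_le
    · exact ⟨⟨-3, 1⟩, by ext <;> simp⟩
    · exact ⟨⟨5, -1⟩, by ext <;> simp⟩
    · exact ⟨⟨6, -1⟩, by ext <;> simp⟩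
    · exact ⟨⟨-5, 2⟩, by ext <;> simp⟩
  · exact span_singleton_le_mul ⟨1, 1⟩ 3 2 ⟨0, 1⟩ (Or.inr rfl) (Or.inl rfl) (Or.inl rfl) (Or.inr rfl) 1 (-1) (by ext <;> simp)

/-- **`𝔭₂𝔭₅ = (5 + √15)`** with `𝔭₅ = (5, √15)`: quotients `10 = γ(5−√15)`, `2√15 = γ(−3+√15)`, `5(1+√15) = γ(−5+2√15)`,
`√15(1+√15) = γ(6−√15)`; and `γ = 1·((1+√15)·5) − 2·(2·√15)`. Norm `+10`: ALLOWED. [kernel] -/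
theorem p2_p5_sqrt15 :
    Ideal.span {(2 : ℤ√15), ⟨1, 1⟩} * Ideal.span {(5 : ℤ√15), ⟨0, 1⟩} = Ideal.span {(⟨5, 1⟩ : ℤ√15)} := by
  apply le_antisymm
  · apply span_pair_mul_le
    · exact ⟨⟨5, -1⟩, by ext <;> simp⟩
    · exact ⟨⟨-3, 1⟩, by ext <;> simp⟩
    · exact ⟨⟨-5, 2⟩, by ext <;> simp⟩
    · exact ⟨⟨6, -1⟩, by ext <;> simp⟩
  · exact span_singleton_le_mul ⟨1, 1⟩ 5 2 ⟨0, 1⟩ (Or.inr rfl) (Or.inl rfl) (Or.inl rfl) (Or.inr rfl) 1 (-2) (by ext <;> simp)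

/-- **`𝔭₃𝔭₅ = (√15)`**: the generator products `15 = √15·√15`, `3√15`, `5√15`, `√15·√15` are multiples of `√15`, and
`√15 = 2·(3·√15) + (−1)·(√15·5)`. Norm `−15`: FORBIDDEN (sign). [kernel] -/
theorem p3_p5_sqrt15 :
    Ideal.span {(3 : ℤ√15), ⟨0, 1⟩} * Ideal.span {(5 : ℤ√15), ⟨0, 1⟩} = Ideal.span {(⟨0, 1⟩ : ℤ√15)} := by
  apply le_antisymm
  · apply span_pair_mul_le
    · exact ⟨⟨0, 1⟩, by ext <;> simp⟩
    · exact ⟨3, by ext <;> simp⟩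
    · exact ⟨5, by ext <;> simp⟩
    · exact ⟨⟨0, 1⟩, by ext <;> simp⟩
  · exact span_singleton_le_mul 3 ⟨0, 1⟩ ⟨0, 1⟩ 5 (Or.inl rfl) (Or.inr rfl) (Or.inr rfl) (Or.inl rfl) 2 (-1) (by ext <;> simp)

/-- **`𝔭₃𝔭₇ = (6 + √15)`** with `𝔭₇ = (7, −1+√15)` (the prime above 7 containing `6 + √15`): quotients `21 = γ(6−√15)`,
`3(−1+√15) = γ(−3+√15)`, `7√15 = γ(−5+2√15)`, `√15(−1+√15) = γ(5−√15)`; and `γ = 1·(3·7) − 1·(√15·(−1+√15))`. Norm `+21`: ALLOWED. [kernel] -/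
theorem p3_p7_sqrt15 :
    Ideal.span {(3 : ℤ√15), ⟨0, 1⟩} * Ideal.span {(7 : ℤ√15), ⟨-1, 1⟩} = Ideal.span {(⟨6, 1⟩ : ℤ√15)} := by
  apply le_antisymm
  · apply span_pair_mul_le
    · exact ⟨⟨6, -1⟩, by ext <;> simp⟩
    · exact ⟨⟨-3, 1⟩, by ext <;> simp⟩
    · exact ⟨⟨-5, 2⟩, by ext <;> simp⟩
    · exact ⟨⟨5, -1⟩, by ext <;> simp⟩
  · exact span_singleton_le_mul 3 7 ⟨0, 1⟩ ⟨-1, 1⟩ (Or.inl rfl) (Or.inl rfl) (Or.inr rfl) (Or.inr rfl) 1 (-1) (by ext <;> simp)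

/-- **Norms in `ℤ√15` and their signs**: `N(3+√15) = −6`, `N(5+√15) = 10`, `N(√15) = −15`, `N(6+√15) = 21`. [kernel, `decide`] -/
theorem norms_sqrt15 :
    (⟨3, 1⟩ : ℤ√15) * ⟨3, -1⟩ = -6 ∧ (⟨5, 1⟩ : ℤ√15) * ⟨5, -1⟩ = 10 ∧ (⟨0, 1⟩ : ℤ√15) * ⟨0, -1⟩ = -15 ∧ (⟨6, 1⟩ : ℤ√15) * ⟨6, -1⟩ = 21 := by
  decide

/-- **No unit of norm `−1` in `ℤ√15`**: `x² − 15y² ≠ −1` (mod 3: `−1` is not a square). So a principal product of NEGATIVE norm (`(3+√15)`,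
`(√15)`) cannot be re-signed: the six SIGN-forbidden pairs of the census. [kernel] -/
theorem no_norm_neg_one_sqrt15 (x y : ℤ) : x ^ 2 - 15 * y ^ 2 ≠ -1 := by
  intro hk
  have h := congrArg (Int.cast : ℤ → ZMod 3) hk
  push_cast at h
  have h15 : (15 : ZMod 3) = 0 := by decide
  rw [h15, zero_mul, sub_zero] at h
  have sq : ∀ a : ZMod 3, a ^ 2 ≠ -1 := by decide
  exact sq _ h

/-- **No element of `ℤ√15` has norm `±2`, `±3` or `±7`** (mod 5: squares are `0, 1, 4`; `±2, ±3, ±7 ≡ 2, 3`): `𝔭₂, 𝔭₃, 𝔭₇` (ideal norms 2, 3, 7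
by value) are not principal. [kernel] -/
theorem no_small_norms_sqrt15 (x y : ℤ) :
    x ^ 2 - 15 * y ^ 2 ≠ 2 ∧ x ^ 2 - 15 * y ^ 2 ≠ -2 ∧ x ^ 2 - 15 * y ^ 2 ≠ 3 ∧ x ^ 2 - 15 * y ^ 2 ≠ -3 ∧
      x ^ 2 - 15 * y ^ 2 ≠ 7 ∧ x ^ 2 - 15 * y ^ 2 ≠ -7 := by
  have key : ∀ k : ℤ, x ^ 2 - 15 * y ^ 2 = k → (x : ZMod 5) ^ 2 = (k : ZMod 5) := by
    intro k hk
    have h := congrArg (Int.cast : ℤ → ZMod 5) hk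
    push_cast at h
    have h15 : (15 : ZMod 5) = 0 := by decide
    rw [h15, zero_mul, sub_zero] at h
    exact h
  have sq : ∀ a : ZMod 5, a ^ 2 ≠ 2 ∧ a ^ 2 ≠ -2 ∧ a ^ 2 ≠ 3 ∧ a ^ 2 ≠ -3 ∧ a ^ 2 ≠ 7 ∧ a ^ 2 ≠ -7 := by decide
  refine ⟨fun h => (sq _).1 (by simpa using key 2 h), fun h => (sq _).2.1 (by simpa using key (-2) h),
    fun h => (sq _).2.2.1 (by simpa using key 3 h), fun h => (sq _).2.2.2.1 (by simpa using key (-3) h),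
    fun h => (sq _).2.2.2.2.1 (by simpa using key 7 h), fun h => (sq _).2.2.2.2.2 (by simpa using key (-7) h)⟩

/-- **The prime above 5 in `ℤ√15` is not principal either**: `x² − 15y² ≠ ±5` (`x = 5x′` ⇒ `5x′² − 3y² = ±1`, impossible mod 5:
`−3y² ≡ ±1` needs `y² ≡ 3` resp. `y² ≡ 2`). [kernel] -/
theorem no_norm_five_sqrt15 (x y : ℤ) : x ^ 2 - 15 * y ^ 2 ≠ 5 ∧ x ^ 2 - 15 * y ^ 2 ≠ -5 := by
  have sq5 : ∀ a : ZMod 5, a ^ 2 = 0 → a = 0 := by decide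
  have aux : ∀ ε : ℤ, (ε = 1 ∨ ε = -1) → x ^ 2 - 15 * y ^ 2 ≠ 5 * ε := by
    intro ε hε hk
    -- 5 ∣ x
    have hx5 : (x : ZMod 5) = 0 := by
      apply sq5
      have h := congrArg (Int.cast : ℤ → ZMod 5) hk
      push_cast at h
      have h15 : (15 : ZMod 5) = 0 := by decide
      have h5 : (5 : ZMod 5) = 0 := by decide
      rw [h15, h5, zero_mul, zero_mul, sub_zero] at h
      exact h
    obtain ⟨x', hx'⟩ := (ZMod.intCast_zmod_eq_zero_iff_dvd x 5).1 hx5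
    rw [hx'] at hk
    push_cast at hk
    have e5 : (5 : ℤ) * (5 * x' ^ 2 - 3 * y ^ 2) = 5 * ε := by linear_combination hk
    have hk' : 5 * x' ^ 2 - 3 * y ^ 2 = ε := mul_left_cancel₀ (by norm_num) e5
    have h := congrArg (Int.cast : ℤ → ZMod 5) hk'
    push_cast at h
    have h5 : (5 : ZMod 5) = 0 := by decide
    rw [h5, zero_mul, zero_sub] at h
    have sq : ∀ a : ZMod 5, -(3 * a ^ 2) ≠ 1 ∧ -(3 * a ^ 2) ≠ -1 := by decide
    rcases hε with rfl | rfl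
    · exact (sq _).1 (by simpa using h)
    · exact (sq _).2 (by simpa using h)
  exact ⟨by simpa using aux 1 (Or.inl rfl), by simpa using aux (-1) (Or.inr rfl)⟩

end Summit.Ventures.HSemireg.RealPairCensus
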